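import Mathlib.NumberTheory.ModularForms.Discriminant
import Mathlib.NumberTheory.ModularForms.LevelOne.Basic
import Mathlib.NumberTheory.ModularForms.LevelOne.DimensionFormula
import Mathlib.NumberTheory.LSeries.Basic
import Mathlib.Analysis.MellinTransform
import HarnessLib

/-!
# The Davenport–Heilbronn phenomenon in degree two at level one: non-eigen cusp forms for `SL(2, ℤ)` (Conrey–Ghosh 1994, Booker–Thorne 2014)

Scope note for the barrier `Literature.Barriers.RiemannHypothesis.DavenportHeilbronn` /
`DavenportHeilbronnNarrow` (file `DavenportHeilbronn.lean`), recorded as named facts (D-0014). The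
narrowed barrier record says, in `scope_caveats:` (a) and in `evasions_known:`, that at conductor `1`
a Dirichlet series with `ζ`'s own functional equation is already `Cζ(s)` (Hamburger's theorem,
`Hamburger`), so that "at level `1` these data already force `F = Cζ` and hence the Euler product".
That rigidity is a DEGREE-ONE statement. In degree two it fails: a cusp form `g ∈ S_k(SL(2, ℤ))` with
rational integer Fourier coefficients that is not a Hecke eigenform (the first examples have weight
`k = 24`, where `dim S_24 = 2`: `Δ²`, `Δ·E₄³`) has an `L`-series with integer coefficients, conductor
`1`, the exact self-dual level-one functional equation `Λ_g(s) = Λ_g(k − s)` (`Λ_g(s) = ∫_0^∞ g(iy)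
y^{s−1} dy = (2π)^{−s}Γ(s)L(s,g)`, `k ≡ 0 mod 4`) and tempered coefficients — and nevertheless
infinitely many zeros in the half-plane of absolute convergence `σ > (k+1)/2`, hence off its critical
line `σ = k/2`. So "conductor `1` + integer coefficients + exact Riemann-type functional equation +
temperedness" excludes off-line zeros only in degree one.

## Sources (read)

* [ConreyGhosh1994] J. B. Conrey, A. Ghosh, *Turán inequalities and zeros of Dirichlet series
  associated with certain cusp forms*, Trans. Amer. Math. Soc. 342 (1994), 407–419 (held, read in
  full). §5: a one-parameter family `ξ_k(s) = γ_k(s)A_k(s)`, `ξ_k(s) = ξ_k(k/2 − s)`, built from `η^k`;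
  "(4) for all other `k` [than `1,2,3,4,6,8,12,24`] there are infinitely many complex zeros outside the
  critical strip". §8, p. 414: "We will illustrate the method of [Davenport–Heilbronn] in the case that
  `k = 48`. **Theorem 2.** The function `ξ_48(s)` has infinitely many zeros in the half plane
  `σ > 25/2`. Remark. The critical line for `ξ_48(s)` is `σ = 12`. The critical strip is
  `23/2 < σ < 25/2`." Proof, p. 415: "The Dirichlet series associated with `ξ_48` is
  `F(s) = ∑ f(n) n^{−s}` where `∑ f(n)e(nz) = Δ(z)²`. Since `Δ(z)` is a cusp form of weight 12 for the
  full modular group, it follows that `Δ(z)²` is a cusp form of weight 24 for the full modular group.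
  It is well known that the space of cusp forms of weight 24 for the full modular group has dimension
  2 … `F(s) = C(A(s) − B(s))`" (`A`, `B` the `L`-series of the two Hecke eigenforms), then Deligne's
  bound, a Rankin–Selberg lower bound (Lemma, §9, via Shahidi), Kronecker's theorem and Rouché:
  "`G(s)` has infinitely many zeros in `σ > 1`", `G(s) = F(s + 23/2)/C`.
* [BookerThorne2014] A. R. Booker, F. Thorne, *Zeros of L-functions outside the critical strip*,
  Algebra Number Theory 8 (2014), 2027–2042 (held as arXiv:1306.6362, read; theorem numbering of that
  text). **Theorem 1.** "Let `f ∈ S_k(Γ₁(N))` be a holomorphic cuspform of arbitrary weight and level.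
  If the associated complete `L`-function `Λ_f(s) = ∫_0^∞ f(iy)y^{s−1} dy` does not vanish for
  `Re(s) > (k+1)/2` then `f` is an eigenfunction of the Hecke operators `T_p` for all primes `p ∤ N`."
  (a corollary of their Theorem 2 on polynomials in automorphic `L`-functions; §1, second Remark: "if
  `P(L(s,π₁),…,L(s,πₙ))` has at least one zero with real part `> 1` then it must have infinitely many
  such zeros. In fact, our proof shows that there is some number `η > 0` such that for any `σ₁, σ₂`
  with `1 < σ₁ < σ₂ ≤ 1 + η`, we have `#{s : Re(s) ∈ [σ₁,σ₂], Im(s) ∈ [−T,T], P(…) = 0} ≫ T` for `T`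
  sufficiently large", proved at the end of §4.)
* [DiamondShurman2005] F. Diamond, J. Shurman, *A First Course in Modular Forms*, Prop. 5.2.2 and
  eq. (5.4) (held, read): `a_n(T_p f) = a_{np}(f) + χ(p)p^{k−1}a_{n/p}(f)` for `f ∈ M_k(N, χ)`
  (`a_{n/p} := 0` if `p ∤ n`); at `N = 1` the character is trivial.

## Rendering

* Level one is Mathlib's `CuspForm 𝒮ℒ k` (`𝒮ℒ` = image of `SL(2, ℤ)` in `GL(2, ℝ)`,
  `Mathlib.NumberTheory.ModularForms.ArithmeticSubgroups`); Fourier coefficients are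
  `(UpperHalfPlane.qExpansion 1 f).coeff n` (genuine: `hasSum_qExpansion`, strict period `1`,
  `one_mem_strictPeriods_SL`); `Δ` is `ModularForm.discriminant` (`CuspForm.discriminant : CuspForm 𝒮ℒ 12`).
* Mathlib has no Hecke operators on modular forms; "`f` is an eigenfunction of `T_p`" at level `1` is
  rendered on `q`-expansions by (5.4) with trivial character: `IsLevelOneHeckeEigenAt k a p`
  (`∃ λ, ∀ n, a(pn) + p^{k−1}·a(n/p) = λ·a(n)`, the `a(n/p)` term present only when `p ∣ n`).
* `Λ_f(s) = ∫_0^∞ f(iy) y^{s−1} dy` is Mathlib's `mellin (fun y ↦ f(iy)) s` (`cuspFormLambda`); for a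
  cusp form the integral converges absolutely for every `s` (exponential decay at `∞`, and at `0` by
  `f(i/y) = (iy)^k f(iy)`), so no junk value of the Bochner integral intervenes.
* Booker–Thorne's Theorem 1 is vendored SPECIALISED TO `N = 1` (`BookerThorne2014_thm1_levelOne`) —
  strictly weaker than print (for `Γ₁(N)` one would need the diamond operators) — together with the
  infinitely-many / `≫ T` form that their §1 Remark and §4 give for the same objects
  (`BookerThorne2014_levelOne_zeros`; zeros of `P(L(·,π_j))` in `1 < σ₁ ≤ Re s ≤ σ₂` correspond to
  zeros of `Λ_f` in `(k+1)/2 < σ₁ + (k−1)/2 ≤ Re s ≤ σ₂ + (k−1)/2`, the `Γ`-factor and `(2π)^{−s}`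
  having no zeros).
* Conrey–Ghosh's Theorem 2 is vendored for the Dirichlet series `F(s) = ∑ f(n)n^{−s}` of `Δ²` itself
  (zeros of `ξ_48 = γ_48·F` in `σ > 25/2` are zeros of `F` there): Mathlib's `LSeries f s` with the
  witness condition `LSeriesSummable f s` added, so that the recorded zeros are genuine zeros of the
  convergent series and not the junk value `0` of a divergent `tsum` (`σ > 25/2 = (k+1)/2`, `k = 24`,
  is the half-plane of absolute convergence by Deligne's bound, as used in the printed proof).

What is NOT here: the functional equation / analytic continuation of `Λ_f` (not needed: every
statement lives in the half-plane of absolute convergence), Hecke operators for `Γ₁(N)`, Deligne's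
bound, and the Conrey–Ghosh family `ξ_k` for non-integral `k/24`.
-/

noncomputable section

open UpperHalfPlane
open scoped MatrixGroups

namespace Literature.Barriers.RiemannHypothesis

/-! ## Level-one vocabulary -/

/-- "`f` is an eigenfunction of the Hecke operator `T_p`" for a level-one form of weight `k` with
Fourier coefficients `a : ℕ → ℂ` (`f = ∑ a(n)qⁿ`), rendered on `q`-expansions: by
`a_n(T_p f) = a_{np}(f) + χ(p)p^{k−1}a_{n/p}(f)` for `f ∈ M_k(N, χ)` (here `N = 1`, `χ` trivial,
`a_{n/p} := 0` when `p ∤ n`), `T_p f = λ f` reads `∀ n, a(pn) + p^{k−1}a(n/p) = λ a(n)`.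
[cite: DiamondShurman2005, Prop. 5.2.2, eq. (5.4)] -/
def IsLevelOneHeckeEigenAt (k : ℤ) (a : ℕ → ℂ) (p : ℕ) : Prop :=
  ∃ l : ℂ, ∀ n : ℕ, a (p * n) + (p : ℂ) ^ (k - 1) * (if p ∣ n then a (n / p) else 0) = l * a n

/-- The complete `L`-function of a level-one cusp form as Booker–Thorne write it,
`Λ_f(s) = ∫_0^∞ f(iy) y^{s−1} dy` — Mathlib's Mellin transform `mellin (y ↦ f(iy)) s =
∫_{(0,∞)} y^{s−1} f(iy) dy` (absolutely convergent for every `s` since `f` is a cusp form; for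
`Re s > k/2 + 1` it equals `(2π)^{−s}Γ(s)∑ a(n)n^{−s}`). The point `iy ∈ ℍ` is
`UpperHalfPlane.ofComplex (I·y)` (`y > 0` on the domain of integration).
[cite: BookerThorne2014, Thm. 1 (definition of Λ_f)] -/
def cuspFormLambda {k : ℤ} (f : CuspForm 𝒮ℒ k) (s : ℂ) : ℂ :=
  mellin (fun y : ℝ ↦ f (ofComplex (Complex.I * (y : ℂ)))) s

/-- The Dirichlet coefficients `f(n)` of `Δ²`: "`F(s) = ∑ f(n) n^{−s}` where `∑ f(n)e(nz) = Δ(z)²`"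
(a cusp form of weight `24` for the full modular group with `f(1) = 0`, `f(2) = 1`, hence not a Hecke
eigenform; `dim S_24 = 2`), as the `q`-expansion coefficients (period `1`) of
`z ↦ Δ(z)²`, `Δ = ModularForm.discriminant = η^24`. [cite: ConreyGhosh1994, §8, proof of Thm. 2 (p. 415)] -/
def deltaSqCoeff (n : ℕ) : ℂ :=
  (qExpansion 1 (fun z : ℍ ↦ ModularForm.discriminant z ^ 2)).coeff n

/-! ## The printed results as named facts (D-0014) -/

/-- **Booker–Thorne 2014, Theorem 1, at level `N = 1`.** Printed: "Let `f ∈ S_k(Γ₁(N))` be a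
holomorphic cuspform of arbitrary weight and level. If the associated complete `L`-function
`Λ_f(s) = ∫_0^∞ f(iy)y^{s−1} dy` does not vanish for `Re(s) > (k+1)/2` then `f` is an eigenfunction
of the Hecke operators `T_p` for all primes `p ∤ N`." Vendored for `N = 1` only (`Γ₁(1) = SL(2, ℤ)`,
every prime qualifies; `T_p`-eigenfunction rendered by `IsLevelOneHeckeEigenAt` on the `q`-expansion)
— WEAKER than print. Role: the degree-two, conductor-one counterpart of the Davenport–Heilbronn
phenomenon; among level-one cusp forms "no zeros in the half-plane of absolute convergence"
characterises the Hecke eigenforms, i.e. the Euler product. [cite: BookerThorne2014, Thm. 1] -/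
def BookerThorne2014_thm1_levelOne : Prop :=
  ∀ (k : ℤ) (f : CuspForm 𝒮ℒ k),
    (∀ s : ℂ, ((k : ℝ) + 1) / 2 < s.re → cuspFormLambda f s ≠ 0) →
      ∀ p : ℕ, p.Prime → IsLevelOneHeckeEigenAt k (fun n ↦ (qExpansion 1 f).coeff n) p

/-- **Booker–Thorne 2014, Theorem 1 with the second Remark of §1 (proved at the end of §4), at level
`N = 1`: infinitely many — indeed `≫ T` — zeros in the half-plane of absolute convergence.** Printed
(for the polynomial `P(L(s,π₁),…,L(s,πₙ))` of their Theorem 2, of which Theorem 1 is the case of a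
linear `P` in the Hecke eigenforms, shifted by `(k−1)/2`): "if `P(…)` has at least one zero with real
part `> 1` then it must have infinitely many such zeros. In fact, our proof shows that there is some
number `η = η(P; π₁,…,πₙ) > 0` such that for any `σ₁, σ₂` with `1 < σ₁ < σ₂ ≤ 1 + η`, we have
`#{s ∈ ℂ : Re(s) ∈ [σ₁,σ₂], Im(s) ∈ [−T,T], P(L(s,π₁),…,L(s,πₙ)) = 0} ≫ T` for `T` sufficiently
large". Here, for a level-one cusp form `f` of weight `k` that is NOT an eigenfunction of some `T_p`:
there is `η > 0` such that for all `(k+1)/2 < σ₁ < σ₂ ≤ (k+1)/2 + η` there are `c > 0`, `T₀` with at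
least `cT` distinct zeros of `Λ_f` in `σ₁ ≤ Re s ≤ σ₂`, `|Im s| ≤ T`, for every `T ≥ T₀` (witnessed
by finite sets of zeros, as in `SaiasWeingartner`). In particular `Λ_f` — equivalently
`L(s,f) = ∑ a(n)n^{−s}`, as `(2π)^{−s}Γ(s) ≠ 0` — has infinitely many zeros with `Re s > (k+1)/2`,
off the critical line `Re s = k/2` of its functional equation `Λ_f(s) = i^k Λ_f(k−s)`.
[cite: BookerThorne2014, Thm. 1 and §1, Remark 2 (with the end of §4)] -/
def BookerThorne2014_levelOne_zeros : Prop :=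
  ∀ (k : ℤ) (f : CuspForm 𝒮ℒ k),
    (∃ p : ℕ, p.Prime ∧ ¬ IsLevelOneHeckeEigenAt k (fun n ↦ (qExpansion 1 f).coeff n) p) →
      ∃ η : ℝ, 0 < η ∧ ∀ σ₁ σ₂ : ℝ, ((k : ℝ) + 1) / 2 < σ₁ → σ₁ < σ₂ → σ₂ ≤ ((k : ℝ) + 1) / 2 + η →
        ∃ c : ℝ, 0 < c ∧ ∃ T₀ : ℝ, ∀ T : ℝ, T₀ ≤ T →
          ∃ Z : Finset ℂ, c * T ≤ Z.card ∧ ∀ s ∈ Z,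
            σ₁ ≤ s.re ∧ s.re ≤ σ₂ ∧ |s.im| ≤ T ∧ cuspFormLambda f s = 0

/-- **Conrey–Ghosh 1994, Theorem 2.** "The function `ξ_48(s)` has infinitely many zeros in the half
plane `σ > 25/2`." Here `ξ_48(s) = γ_48(s)F(s)` with "`F(s) = ∑ f(n) n^{−s}` where `∑ f(n)e(nz) =
Δ(z)²`", a weight-`24` cusp form for `SL(2, ℤ)` with integer coefficients which is not a Hecke
eigenform ("the space of cusp forms of weight 24 for the full modular group has dimension 2 …
`F(s) = C(A(s) − B(s))`"); "The critical line for `ξ_48(s)` is `σ = 12`. The critical strip is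
`23/2 < σ < 25/2`." Rendered for `F` itself (the `Γ`-factor has no zeros): infinitely many `s` with
`Re s > 25/2` at which the Dirichlet series `∑ f(n)n^{−s}` CONVERGES (witness condition
`LSeriesSummable`, automatic in print by Deligne's bound, `25/2 = (k+1)/2`) and vanishes. The first
explicit instance of `BookerThorne2014_thm1_levelOne`; proof by Davenport–Heilbronn's method
(Deligne's bound, Rankin–Selberg, Kronecker, Rouché). [cite: ConreyGhosh1994, Thm. 2 (§8, p. 414; proof pp. 415–418)] -/
def ConreyGhosh1994_thm2 : Prop :=
  {s : ℂ | (25 / 2 : ℝ) < s.re ∧ LSeriesSummable deltaSqCoeff s ∧ LSeries deltaSqCoeff s = 0}.Infinite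

/-! ## Elementary consequences (proved) -/

/-- Under `BookerThorne2014_thm1_levelOne`, a level-one cusp form that fails to be a `T_p`-eigenfunction
for some prime `p` has a zero of `Λ_f` in the half-plane of absolute convergence `Re s > (k+1)/2`
(contrapositive of the printed theorem). [cite: BookerThorne2014, Thm. 1] -/
theorem BookerThorne2014_thm1_levelOne.exists_zero (h : BookerThorne2014_thm1_levelOne) {k : ℤ}
    (f : CuspForm 𝒮ℒ k) {p : ℕ} (hp : p.Prime)
    (hf : ¬ IsLevelOneHeckeEigenAt k (fun n ↦ (qExpansion 1 f).coeff n) p) :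
    ∃ s : ℂ, ((k : ℝ) + 1) / 2 < s.re ∧ cuspFormLambda f s = 0 := by
  by_contra hs
  push Not at hs
  exact hf (h k f (fun s hs' ↦ hs s hs') p hp)

/-- Under `BookerThorne2014_levelOne_zeros`, such a form has infinitely many zeros of `Λ_f` with
`Re s > (k+1)/2` (take the strip `[(k+1)/2 + η/2, (k+1)/2 + η]` and let `T → ∞`).
[cite: BookerThorne2014, Thm. 1 and §1, Remark 2] -/
theorem BookerThorne2014_levelOne_zeros.infinite (h : BookerThorne2014_levelOne_zeros) {k : ℤ}
    (f : CuspForm 𝒮ℒ k) {p : ℕ} (hp : p.Prime)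
    (hf : ¬ IsLevelOneHeckeEigenAt k (fun n ↦ (qExpansion 1 f).coeff n) p) :
    {s : ℂ | ((k : ℝ) + 1) / 2 < s.re ∧ cuspFormLambda f s = 0}.Infinite := by
  obtain ⟨η, hη, hstrip⟩ := h k f ⟨p, hp, hf⟩
  set σ₀ : ℝ := ((k : ℝ) + 1) / 2 with hσ₀
  obtain ⟨c, hc, T₀, hT⟩ :=
    hstrip (σ₀ + η / 2) (σ₀ + η) (by linarith) (by linarith) (by linarith)
  intro hfin
  -- a finite zero set has bounded cardinality, but the strip carries ≥ cT zeros for all large T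
  set S : Set ℂ := {s : ℂ | ((k : ℝ) + 1) / 2 < s.re ∧ cuspFormLambda f s = 0} with hS
  obtain ⟨T, hT₀, hbig⟩ : ∃ T : ℝ, T₀ ≤ T ∧ (hfin.toFinset.card : ℝ) < c * T := by
    refine ⟨max T₀ ((hfin.toFinset.card + 1) / c), le_max_left _ _, ?_⟩
    have h1 : ((hfin.toFinset.card : ℝ) + 1) / c ≤ max T₀ ((hfin.toFinset.card + 1) / c) :=
      le_max_right _ _
    have h2 : c * (((hfin.toFinset.card : ℝ) + 1) / c) = hfin.toFinset.card + 1 := by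
      field_simp
    nlinarith [mul_le_mul_of_nonneg_left h1 hc.le]
  obtain ⟨Z, hZcard, hZ⟩ := hT T hT₀
  have hsub : Z ⊆ hfin.toFinset := by
    intro s hs
    obtain ⟨h1, -, -, h4⟩ := hZ s hs
    simp only [Set.Finite.mem_toFinset, hS, Set.mem_setOf_eq]
    exact ⟨by linarith, h4⟩
  have := Finset.card_le_card hsub
  have : (Z.card : ℝ) ≤ hfin.toFinset.card := by exact_mod_cast this
  linarith

/-! ## Sanity checks on the rendering of `Δ²` (proved) -/

/-- The `q`-expansion of `Δ²` is the square of that of `Δ` (Mathlib's `qExpansion_mul`, the cusp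
function of `Δ` being analytic at `q = 0`). [folklore] -/
theorem qExpansion_discriminant_sq :
    qExpansion 1 (fun z : ℍ ↦ ModularForm.discriminant z ^ 2) =
      qExpansion 1 ModularForm.discriminant ^ 2 := by
  have hΔ : AnalyticAt ℂ (cuspFunction 1 ModularForm.discriminant) 0 := by
    simpa using ModularFormClass.analyticAt_cuspFunction_zero CuspForm.discriminant one_pos
      one_mem_strictPeriods_SL
  have h2 : (fun z : ℍ ↦ ModularForm.discriminant z ^ 2) =
      ModularForm.discriminant * ModularForm.discriminant := by
    funext z; simp [sq]
  rw [h2, sq, qExpansion_mul hΔ hΔ]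

/-- Hence `f(n) = ∑_{i+j=n} τ(i)τ(j)` with `τ(i)` the `q`-expansion coefficients of `Δ`
(Ramanujan's `τ`, `τ(0) = 0`). [folklore] -/
theorem deltaSqCoeff_eq (n : ℕ) :
    deltaSqCoeff n = ∑ ij ∈ Finset.antidiagonal n,
      (qExpansion 1 ModularForm.discriminant).coeff ij.1 *
        (qExpansion 1 ModularForm.discriminant).coeff ij.2 := by
  rw [deltaSqCoeff, qExpansion_discriminant_sq, sq, PowerSeries.coeff_mul]

/-- `τ(0) = 0`: the constant term of the `q`-expansion of `Δ` vanishes (`Δ` has order `1` at the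
cusp, Mathlib `ModularForm.discriminant_qExpansion_order`). [folklore] -/
theorem qExpansion_discriminant_coeff_zero :
    (qExpansion 1 ModularForm.discriminant).coeff 0 = 0 := by
  apply PowerSeries.coeff_of_lt_order
  simp [ModularForm.discriminant_qExpansion_order]

/-- `f(1) = 0` and `f(2) = 1` (`Δ² = q² − 48q³ + ⋯`): in particular `Δ²` is not a normalised Hecke
eigenform, and `f(2) ≠ λ·f(1)`-type relations fail (`T_2`: `f(2) + 2^23·0 = λ f(1)` forces
`f(2) = 0`). [folklore] -/
theorem deltaSqCoeff_one_two : deltaSqCoeff 1 = 0 ∧ deltaSqCoeff 2 = 1 := by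
  have h0 := qExpansion_discriminant_coeff_zero
  have h1 : (qExpansion 1 ModularForm.discriminant).coeff 1 = 1 :=
    ModularForm.discriminant_qExpansion_coeff_one
  refine ⟨?_, ?_⟩
  · rw [deltaSqCoeff_eq, Finset.Nat.antidiagonal_succ]
    simp [h0]
  · rw [deltaSqCoeff_eq]
    have : Finset.antidiagonal 2 = {(0, 2), (1, 1), (2, 0)} := by decide
    rw [this]
    simp [h0, h1]

/-- Consequently `Δ²` is not an eigenfunction of `T_2` in the sense of `IsLevelOneHeckeEigenAt`
(weight `24`): the relation at `n = 1` reads `f(2) = λ f(1)`, i.e. `1 = 0`. [folklore] -/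
theorem not_isLevelOneHeckeEigenAt_deltaSq : ¬ IsLevelOneHeckeEigenAt 24 deltaSqCoeff 2 := by
  rintro ⟨l, hl⟩
  have h := hl 1
  obtain ⟨h1, h2⟩ := deltaSqCoeff_one_two
  norm_num [h1, h2] at h

end Literature.Barriers.RiemannHypothesis
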